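import Summits.RiemannHypothesis.RiemannHypothesis.Theorems.PfPersistencePerronFakeNodelessFoldBarrier
import HarnessLib

/-!
# PF persistence — PERRON-FAKE (S6), part 5e: the EVEN FOLD BARRIER for EVERY real table
# (the full windowed form of an arbitrary real table is NOT even-sign-improving on the
# finite-energy class at any window `a ≥ 3/10` — every served window of the campaign)

`pub-rhpf` cell, unit `pub-rhpf-prover-perron` (S6; CASE-DAG §6 row PERRON-FAKE; leaves G1.01 / G1.02,
FAKE column; table-side reading of leaf G1.19).  **Mechanism / rigidity campaign; no RH claims.**
RH-free, definition-free: Mathlib + proved tree files only.  A NEGATIVE-SIDE output of the S6 line.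

* `exists_even_fold_lt_of_ge` — for every real table `w` and every `a ≥ 3/10` an explicit smooth
  real EVEN `u ∈ coreAdm a` (the even bump of radius `1/300` at `0` minus the symmetrised bump at
  `±89/300`: separation `29/100 > 0.2812…`, and no prime length joins the lobes) with
  `Q^w_a(u) < Q^w_a(|u|)`, by the abstract witness `fold_lt_of_separated` of part 5d;
* `not_forall_evenFold_le_of_ge` — the negation spelled out: NOT EVEN-SIGN-IMPROVING.

READING (honest scope).  With parts 5c / 5d: for every real table alike, the route `u ↦ |u|` to
even-sector nodelessness of the full form works on `(0, 11/40]` and is UNAVAILABLE from `3/10` on —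
i.e. at EVERY served window (`ζ` census from `a = 0.30`; cells `[0.40, 1.65]`); the true even kernel
threshold `0.2812…` (DERIVED) lies in the gap.  A statement about the METHOD only: nothing here
asserts or denies `AllEvenGroundStatesOneSigned a w` (nodal count of even ground states) at any served
window, for `ζ` or for any control; it generalises the tree's `ζ`-side
`swe_even_not_signImproving_of_ge` (`a ≥ 33/100`) to arbitrary real tables with the better constant
`3/10`.  Nothing here is a statement about positivity of any form.
-/

open MeasureTheory Set Filter Literature.NumberTheory.LFunctions
open Summit.RiemannHypothesis.RiemannHypothesis.Theorems.PolarPerronFrobenius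

namespace Summit.RiemannHypothesis.RiemannHypothesis.Theorems.PfPersistence

variable {a : ℝ}

/-! ### The even barrier at every window `a ≥ 3/10` -/

/-- **The full windowed form of EVERY real table is NOT even-sign-improving at any window
`a ≥ 3/10` (PROVED).**  For every real table `w` and every `a ≥ 3/10` there is a smooth real EVEN `u`
in `coreAdm a` with `Q^w_a(u) < Q^w_a(|u|)` (even bump of radius `1/300` at `0` minus the symmetrised
bump at `±89/300`: separation `29/100 > 0.2812…`, no prime length joins the lobes).  In particular at
every served window of the campaign the Beurling–Deny route to even-sector nodelessness is closed for
every table alike. [folklore] -/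
theorem exists_even_fold_lt_of_ge (w : ℕ → ℝ) (ha : 3 / 10 ≤ a) :
    ∃ u : ℝ → ℝ, Measurable u ∧ coreAdm a (fun x ↦ ((u x : ℝ) : ℂ)) ∧ (∀ x, u (-x) = u x) ∧
      tableClosedForm a w (fun x ↦ ((u x : ℝ) : ℂ)) <
        tableClosedForm a w (fun x ↦ ((|u x| : ℝ) : ℂ)) := by
  let pb : ContDiffBump (0 : ℝ) := ⟨1 / 600, 1 / 300, by norm_num, by norm_num⟩
  let qb : ContDiffBump (89 / 300 : ℝ) := ⟨1 / 600, 1 / 300, by norm_num, by norm_num⟩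
  have hpr : pb.rOut = 1 / 300 := rfl
  have hqr : qb.rOut = 1 / 300 := rfl
  set p : ℝ → ℝ := fun t ↦ (pb : ℝ → ℝ) t + (pb : ℝ → ℝ) (-t) with hpdef
  set q : ℝ → ℝ := fun t ↦ (qb : ℝ → ℝ) t + (qb : ℝ → ℝ) (-t) with hqdef
  have hpbz : ∀ x, (pb : ℝ → ℝ) x ≠ 0 → |x| < 1 / 300 := fun x hx ↦ by
    by_contra h
    exact hx (bump_eq_zero_of_le pb (by rw [hpr, sub_zero]; exact not_lt.1 h))
  have hqbz : ∀ x, (qb : ℝ → ℝ) x ≠ 0 → |x - 89 / 300| < 1 / 300 := fun x hx ↦ by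
    by_contra h
    exact hx (bump_eq_zero_of_le qb (by rw [hqr]; exact not_lt.1 h))
  have hp0 : ∀ x, 0 ≤ p x := fun x ↦ add_nonneg pb.nonneg pb.nonneg
  have hq0 : ∀ x, 0 ≤ q x := fun x ↦ add_nonneg qb.nonneg qb.nonneg
  -- support facts: `p x ≠ 0 ⇒ |x| < 1/300`; `q y ≠ 0 ⇒ 88/300 < |y| < 90/300`
  have hpz : ∀ x, p x ≠ 0 → |x| < 1 / 300 := by
    intro x hx
    by_contra h
    have h1 : (pb : ℝ → ℝ) x = 0 := by by_contra h'; exact h (hpbz x h')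
    have h2 : (pb : ℝ → ℝ) (-x) = 0 := by
      by_contra h'; have := hpbz (-x) h'; rw [abs_neg] at this; exact h this
    exact hx (by simp only [hpdef, h1, h2, add_zero])
  have hqz : ∀ y, q y ≠ 0 → 88 / 300 < |y| ∧ |y| < 90 / 300 := by
    intro y hy
    by_cases h1 : (qb : ℝ → ℝ) y ≠ 0
    · have := hqbz y h1
      rw [abs_lt] at this
      rw [abs_of_pos (by linarith [this.1] : 0 < y)]
      exact ⟨by linarith [this.1], by linarith [this.2]⟩
    · push Not at h1
      have h2 : (qb : ℝ → ℝ) (-y) ≠ 0 := fun h ↦ hy (by simp only [hqdef, h1, h, add_zero])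
      have := hqbz (-y) h2
      rw [abs_lt] at this
      rw [abs_of_neg (by linarith [this.2] : y < 0)]
      exact ⟨by linarith [this.2], by linarith [this.1]⟩
  have hdisj : ∀ x, p x = 0 ∨ q x = 0 := by
    intro x
    by_contra h
    rw [not_or] at h
    have h1 := hpz x h.1
    have h2 := (hqz x h.2).1
    linarith
  set u : ℝ → ℝ := fun x ↦ p x - q x with hudef
  have huc : ContDiff ℝ (⊤ : ℕ∞) u :=
    (contDiff_bump_add_bump_neg pb).sub (contDiff_bump_add_bump_neg qb)
  have hum : Measurable u := huc.continuous.measurable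
  have heven : ∀ x, u (-x) = u x := fun x ↦ by
    simp only [hudef, hpdef, hqdef, neg_neg]; ring
  -- `u` vanishes off `[-3/10, 3/10]`
  have huz : ∀ x, 3 / 10 < |x| → u x = 0 := by
    intro x hx
    have h1 : p x = 0 := by
      by_contra h; have := hpz x h; linarith
    have h2 : q x = 0 := by
      by_contra h; have := (hqz x h).2; linarith
    simp only [hudef, h1, h2, sub_zero]
  obtain ⟨hts, hcs⟩ := tsupport_subset_of_eq_zero huz
  have hW : IsWeilTest fun x ↦ ((u x : ℝ) : ℂ) := sw_isWeilTest_ofReal_comp huc hcs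
  have htsC : tsupport (fun x ↦ ((u x : ℝ) : ℂ)) ⊆ Icc (-a) a := by
    rw [sw_tsupport_ofReal_comp]
    exact hts.trans (Icc_subset_Icc (by linarith) ha)
  have hU : coreAdm a (fun x ↦ ((u x : ℝ) : ℂ)) := coreAdm_of_isWeilTest hW htsC
  -- `u⁺ = p`, `u⁻ = q`
  have hpos : ∀ x, max (u x) 0 = p x := by
    intro x
    rcases hdisj x with h | h
    · simp only [hudef, h, zero_sub, max_eq_right (neg_nonpos.2 (hq0 x))]
    · simp only [hudef, h, sub_zero, max_eq_left (hp0 x)]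
  have hneg : ∀ x, max (-u x) 0 = q x := by
    intro x
    rcases hdisj x with h | h
    · simp only [hudef, h, zero_sub, neg_neg, max_eq_left (hq0 x)]
    · simp only [hudef, h, sub_zero, max_eq_right (neg_nonpos.2 (hp0 x))]
  -- separation `29/100` and prime avoidance
  have hsep : ∀ x y, p x ≠ 0 → q y ≠ 0 → 29 / 100 ≤ |x - y| := by
    intro x y hx hy
    have h1 := hpz x hx
    have h2 := (hqz y hy).1
    have : |y| - |x| ≤ |x - y| := by
      have := abs_sub_abs_le_abs_sub y x
      rwa [abs_sub_comm] at this
    linarith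
  have hprime : ∀ n ∈ weilPrimeIndex a, ∀ y, q y ≠ 0 →
      p (y + Real.log n) = 0 ∧ p (y - Real.log n) = 0 := by
    intro n _ y hy
    obtain ⟨h2, h2'⟩ := hqz y hy
    have hz : ∀ z, 1 / 300 ≤ |z| → p z = 0 := fun z hz ↦ by
      by_contra h; have := hpz z h; linarith
    by_cases hn : n < 2
    · have hl : Real.log (n : ℝ) = 0 := by interval_cases n <;> simp
      rw [hl, add_zero, sub_zero]
      exact ⟨hz y (by linarith), hz y (by linarith)⟩
    · push Not at hn
      have hn' : (2 : ℝ) ≤ n := by exact_mod_cast hn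
      have hl : Real.log 2 ≤ Real.log (n : ℝ) := Real.log_le_log (by norm_num) hn'
      have hl2 := Real.log_two_gt_d9
      have hy' := abs_le.1 h2'.le
      refine ⟨hz _ ?_, hz _ ?_⟩
      · rw [abs_of_pos (by linarith [hy'.1] : 0 < y + Real.log n)]
        linarith [hy'.1]
      · rw [abs_of_neg (by linarith [hy'.2] : y - Real.log n < 0)]
        linarith [hy'.2]
  -- positive masses
  have hpc : Continuous p := (contDiff_bump_add_bump_neg pb).continuous
  have hqc : Continuous q := (contDiff_bump_add_bump_neg qb).continuous
  have hpcs : HasCompactSupport p :=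
    (tsupport_subset_of_eq_zero (b := 1 / 300) fun x hx ↦ by
      by_contra h; have := hpz x h; linarith).2
  have hqcs : HasCompactSupport q :=
    (tsupport_subset_of_eq_zero (b := 90 / 300) fun x hx ↦ by
      by_contra h; have := (hqz x h).2; linarith).2
  have hIp : 0 < ∫ x, p x := by
    refine sw_integral_pos hpc (hpc.integrable_of_hasCompactSupport hpcs) hp0 (x := 0) ?_
    have h := pb.pos_of_mem_ball (Metric.mem_ball_self pb.rOut_pos)
    simp only [hpdef, neg_zero]
    linarith
  have hIq : 0 < ∫ x, q x := by
    refine sw_integral_pos hqc (hqc.integrable_of_hasCompactSupport hqcs) hq0 (x := 89 / 300) ?_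
    have h := qb.pos_of_mem_ball (Metric.mem_ball_self qb.rOut_pos)
    have h' : 0 ≤ (qb : ℝ → ℝ) (-(89 / 300)) := qb.nonneg
    simp only [hqdef]
    linarith
  exact ⟨u, hum, hU, heven, fold_lt_of_separated w hum hU hpos hneg (by norm_num) hsep hprime
    weilArchDensity_lt_two_mul_cosh_of hIp hIq⟩

/-! ### The negation spelled out -/

/-- At every window `a ≥ 3/10` folding RAISES the full form of every real table on some EVEN member
of the finite-energy class: the form is not even-sign-improving there (every served window of the
campaign included). [folklore] -/
theorem not_forall_evenFold_le_of_ge (w : ℕ → ℝ) (ha : 3 / 10 ≤ a) :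
    ¬ ∀ u : ℝ → ℝ, Measurable u → coreAdm a (fun x ↦ ((u x : ℝ) : ℂ)) → (∀ x, u (-x) = u x) →
      tableClosedForm a w (fun x ↦ ((|u x| : ℝ) : ℂ)) ≤
        tableClosedForm a w (fun x ↦ ((u x : ℝ) : ℂ)) := by
  intro h
  obtain ⟨u, hum, hU, he, hlt⟩ := exists_even_fold_lt_of_ge w ha
  exact absurd (h u hum hU he) (not_le.2 hlt)

end Summit.RiemannHypothesis.RiemannHypothesis.Theorems.PfPersistence
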